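import Literature.MathematicalPhysics.QuantumLattice.HubbardModel
import Literature.MathematicalPhysics.QuantumLattice.HubbardWave0LiebProofs
import Literature.MathematicalPhysics.QuantumLattice.HubbardWave0RepulsiveProofs
import HarnessLib

/-!
# Global `SU(2)` invariance of the Hubbard Hamiltonian: discharges of
`commute_hamiltonian_spinVecF` and `commute_hamiltonianWith_spinVecF`

Trunk T-QLATTICE, family `hubbard`. Sibling proof file of
`Literature/MathematicalPhysics/QuantumLattice/HubbardModel.lean`; it proves the two named facts
(`def X : Prop`, D-0014) of that file asserting that the Hubbard Hamiltonian `H(t, U)` on a finite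
graph, and its grand-canonical version `H(t, U) - μ N`, commute with all three components
`S^x = (S⁺ + S⁻)/2`, `S^y = (S⁺ - S⁻)/(2i)`, `S^z` of the total spin (`spinVecF`, file
`FermionOperators`). No statement is introduced or changed here.

## Proof

Pure assembly of results already in the tree:

* `[H, S⁺] = 0`, `[H, S⁻] = 0` — `LiebThm1.hamiltonian_commute_spinPlus/Minus`
  (`HubbardWave0LiebProofs`, bilinear CAR commutators);
* `[H, S^z] = 0` — third component of `hamiltonian_isHermitian_and_commute_holds` (ibid.);
* `[N, S⁺] = [N, S⁻] = [N, S^z] = 0` — `LiebTwo.totalNumber_mul_spinPlus/Minus/spinZ`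
  (`HubbardWave0RepulsiveProofs`; `N` is diagonal in the occupation basis and a spin flip keeps
  the particle number);

combined linearly (`Commute.add_right`, `Commute.sub_right`, `Commute.smul_right`,
`Commute.sub_left`) along `spinVecF = ![(S⁺ + S⁻)/2, -i(S⁺ - S⁻)/2, S^z]` and
`hamiltonianWith G t U μ = hamiltonian G t U - μ • N`.

## Sources

H. Tasaki, *The Hubbard model — an introduction and selected rigorous results*, J. Phys.:
Condens. Matter **10** (1998) 4353, §2.2 "Some physical quantities" (read: arXiv:cond-mat/9512169):
"The total number operator `N̂_e = Σ_x (n_{x↑} + n_{x↓})` commutes with the Hamiltonian `H`", and,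
for the total spin operators `Ŝ^{(α)}_{tot} = Σ_x ½ Σ_{σ,τ} c†_{xσ} (p^{(α)})_{στ} c_{xτ}`,
`α = 1, 2, 3`: "The operator `Ŝ^{(α)}_{tot}` commute with both the hopping Hamiltonian `H_hop` and
with the interaction Hamiltonian `H_int`. In other words, these Hamiltonians are invariant under
any global rotation in the spin space." [Tasaki1998]. The named facts themselves cite the textbook
account H. Tasaki, *Physics and Mathematics of Quantum Many-Body Systems* (2020), §9.3.2
[Tasaki2020]; E. H. Lieb, PRL **62** (1989) 1201, eq. (2) [LiebPRL1989].
-/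

noncomputable section

namespace Literature.MathematicalPhysics.QuantumLattice

open Matrix Finset

section SpinSymmetry

variable {Λ : Type*} [LinearOrder Λ] [Fintype Λ]

/-- `S^x = (S⁺ + S⁻)/2` (first component of `spinVecF`, definitional).
Tasaki (1998) §2.2. [cite: Tasaki1998, §2.2] -/
theorem spinVecF_zero :
    (spinVecF 0 : Matrix (Finset (Orb Λ)) (Finset (Orb Λ)) ℂ) =
      (1 / 2 : ℂ) • (spinPlus + spinMinus) := rfl

/-- `S^y = (S⁺ - S⁻)/(2i) = (-i/2)(S⁺ - S⁻)` (second component of `spinVecF`, definitional).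
Tasaki (1998) §2.2. [cite: Tasaki1998, §2.2] -/
theorem spinVecF_one :
    (spinVecF 1 : Matrix (Finset (Orb Λ)) (Finset (Orb Λ)) ℂ) =
      (-Complex.I / 2) • (spinPlus - spinMinus) := rfl

/-- `S^z` is Wave0's `spinZ` (third component of `spinVecF`, definitional).
Tasaki (1998) §2.2. [cite: Tasaki1998, §2.2] -/
theorem spinVecF_two :
    (spinVecF 2 : Matrix (Finset (Orb Λ)) (Finset (Orb Λ)) ℂ) = HubbardWave0.spinZ := rfl

/-- An operator commuting with `S⁺`, `S⁻` and `S^z` commutes with every component `S^α` of the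
total spin (linearity of the commutator). Tasaki (1998) §2.2. [folklore] -/
theorem commute_spinVecF_of_commute {A : Matrix (Finset (Orb Λ)) (Finset (Orb Λ)) ℂ}
    (hP : Commute A spinPlus) (hM : Commute A spinMinus) (hZ : Commute A HubbardWave0.spinZ)
    (α : Fin 3) : Commute A (spinVecF α) := by
  fin_cases α
  · rw [Fin.zero_eta, spinVecF_zero]
    exact (hP.add_right hM).smul_right _
  · rw [Fin.mk_one, spinVecF_one]
    exact (hP.sub_right hM).smul_right _
  · show Commute A (spinVecF 2)
    rw [spinVecF_two]
    exact hZ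

/-- **`[N, S^α] = 0`**: the total particle number commutes with every component of the total spin
(the spin operators are particle-number preserving fermion bilinears). Tasaki (1998) §2.2.
[cite: Tasaki1998, §2.2] -/
theorem totalNumber_commute_spinVecF (α : Fin 3) :
    Commute (totalNumber : Matrix (Finset (Orb Λ)) (Finset (Orb Λ)) ℂ) (spinVecF α) :=
  commute_spinVecF_of_commute LiebTwo.totalNumber_mul_spinPlus LiebTwo.totalNumber_mul_spinMinus
    LiebTwo.totalNumber_mul_spinZ α

variable (G : SimpleGraph Λ) [DecidableRel G.Adj]

/-- **`[H(t,U), S^α] = 0`** for `α = x, y, z`: the Hubbard Hamiltonian on any finite graph is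
invariant under global spin rotations. Tasaki (1998) §2.2 ("`Ŝ^{(α)}_{tot}` commute with both
`H_hop` and `H_int`"); Lieb, PRL 62 (1989) 1201, eq. (2). [cite: Tasaki1998, §2.2] -/
theorem hamiltonian_commute_spinVecF (t U : ℝ) (α : Fin 3) :
    Commute (hamiltonian G t U) (spinVecF α) :=
  commute_spinVecF_of_commute (LiebThm1.hamiltonian_commute_spinPlus G t U)
    (LiebThm1.hamiltonian_commute_spinMinus G t U)
    (hamiltonian_isHermitian_and_commute_holds G t U).2.2 α

/-- **Discharge of `commute_hamiltonian_spinVecF`** (global `SU(2)` invariance): the Hubbard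
Hamiltonian commutes with every component of the total spin. Tasaki (1998) §2.2; Tasaki (2020)
§9.3.2; Lieb, PRL 62 (1989) 1201, eq. (2). [cite: Tasaki1998, §2.2] -/
theorem commute_hamiltonian_spinVecF_holds : commute_hamiltonian_spinVecF G :=
  fun t U α => hamiltonian_commute_spinVecF G t U α

/-- **Discharge of `commute_hamiltonianWith_spinVecF`**: the grand-canonical Hubbard Hamiltonian
`H(t,U) - μN` also commutes with every component of the total spin, since both `H(t,U)` and the
particle number `N` do. Tasaki (1998) §2.2 ("The total number operator ... commutes with the
Hamiltonian"; "`Ŝ^{(α)}_{tot}` commute with both `H_hop` and `H_int`"); Tasaki (2020) §9.3.2.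
[cite: Tasaki1998, §2.2] -/
theorem commute_hamiltonianWith_spinVecF_holds : commute_hamiltonianWith_spinVecF G := by
  intro t U μ α
  rw [hamiltonianWith_eq]
  exact (hamiltonian_commute_spinVecF G t U α).sub_left
    ((totalNumber_commute_spinVecF α).smul_left (μ : ℂ))

end SpinSymmetry

end Literature.MathematicalPhysics.QuantumLattice
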